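import Summits.CriticalPhenomena.PercolationContinuityZ3.Theorems.Transplant.SkelPhiFaceSlots
import HarnessLib

/-!
# N1 ({±1} node), (F) column slots PER DIRECTION (hp-8 g33): `awF₂ P du := ⌈awNum du / Mabs⌉` (no max over directions) and
# `kFF₂ P Rlev I := ⌈(Mabs·(awF₂ (I,·) + Rlev + 1) + rdN I (bOf I)·(Rlev+2)·D) / (rdK I (bOf I)·D)⌉` (no max over axes), serving the per-direction
# hypotheses `haw du` / `hroomF du` of `faceOblRM_fineNb2` (stmt-g14 18:45:38Z: the maxed slots of `SkelPhiFaceSlots` are infeasible for anisotropic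
# cells; the per-direction ones close with `kFF₂ I ≤ 2·r_{oth I} + 5·Rlev + 15`).
builds on p205010 (kernel theorem, internal audit signed; external expert review pending) — nothing in this file uses p205010; no claim about the open node.
Lane `prim-bschramm`, seat `prim-hp-8` (gen 33); helper file (`--supports stmt-CriticalPhenomena-4575 --as helper`).
* defs **`FinePrm.awF₂`**, **`kFF₂`**; `awNum_eq_axis`, `awF₂_eq_axis`, **`haw_awF₂`**, **`hroomF_kFF₂`**.
[cite: KozmaNitzan2024, §4 Lemma 12 (pp. 23–25), p. 30] [cite: Timar2007, Lemma 2.2, p. 3]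
-/

noncomputable section

open scoped Classical

namespace Summit.CriticalPhenomena.PercolationContinuityZ3.Theorems.Transplant

open Literature.Probability.Percolation Literature.Probability.LatticeModels KNCells
open Literature.Probability.Percolation.KozmaNitzan
open Literature.Probability.Percolation.KozmaNitzan.Cells (oth oth_ne eq_oth_of_ne)
open TwoAxis.Para (modulus detD)

namespace Skelφ

namespace FinePrm

variable (pr : FinePrm)

/-- **`aw` per direction**: `⌈awNum du / Mabs⌉`. [this work] -/
def awF₂ (P : PCells2) (du : MDir) : ℤ := (pr.awNum P du + pr.Mabs - 1) / pr.Mabs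

/-- **`kF` per level axis**: `⌈(Mabs·(awF₂ (I, ·) + Rlev + 1) + rdN I (bOf I)·(Rlev+2)·D) / (rdK I (bOf I)·D)⌉`. [this work] -/
def kFF₂ (P : PCells2) (Rlev : ℕ) (I : Fin 2) : ℤ :=
  (pr.Mabs * (pr.awF₂ P (I, true) + Rlev + 1) + pr.rdN I (pr.bOf I) * (Rlev + 2) * pr.D + pr.rdK I (pr.bOf I) * pr.D - 1) /
    (pr.rdK I (pr.bOf I) * pr.D)

/-- `awNum` depends on the axis of the direction only. [folklore] -/
theorem awNum_eq_axis (P : PCells2) (du : MDir) : pr.awNum P du = pr.awNum P (du.1, true) := rfl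

/-- `awF₂` depends on the axis of the direction only. [folklore] -/
theorem awF₂_eq_axis (P : PCells2) (du : MDir) : pr.awF₂ P du = pr.awF₂ P (du.1, true) := rfl

/-- **`haw` per direction**: `awNum du ≤ Mabs · (awF₂ du + 1)`. [this work] -/
theorem haw_awF₂ (hc₀ : 0 < pr.c₀) (hc₁ : 0 < pr.c₁) (hDd : pr.D = detD pr.A pr.n pr.h pr.vα pr.vβ) (hD : 0 < pr.D) (P : PCells2) (du : MDir) :
    (pr.rdK 1 (pr.bOf du.1) * (P.faceExt du 0 + 1) + pr.rdK 0 (pr.bOf du.1) * (P.faceExt du 1 + 1)) * pr.D ≤ pr.Mabs * (pr.awF₂ P du + 1) := by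
  have hM := pr.Mabs_pos hc₀ hc₁ hDd hD
  have h1 := le_mul_cdiv (a := pr.awNum P du) hM
  show pr.awNum P du ≤ _
  unfold awF₂
  nlinarith

/-- **`hroomF` per direction**: `Mabs·(awF₂ du + Rlev + 1) + rdN du.1 (bOf du.1)·(Rlev+2)·D ≤ rdK du.1 (bOf du.1) · kFF₂ du.1 · D`. [this work] -/
theorem hroomF_kFF₂ (hc₀ : 0 < pr.c₀) (hc₁ : 0 < pr.c₁) (hDd : pr.D = detD pr.A pr.n pr.h pr.vα pr.vβ) (hD : 0 < pr.D) (P : PCells2) (Rlev : ℕ)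
    (du : MDir) : pr.Mabs * (pr.awF₂ P du + Rlev + 1) + pr.rdN du.1 (pr.bOf du.1) * (Rlev + 2) * pr.D ≤
      pr.rdK du.1 (pr.bOf du.1) * pr.kFF₂ P Rlev du.1 * pr.D := by
  have hK := mul_pos (pr.rdK_pos hc₀ hc₁ hDd hD du.1) hD
  rw [pr.awF₂_eq_axis P du]
  have h1 := le_mul_cdiv (a := pr.Mabs * (pr.awF₂ P (du.1, true) + Rlev + 1) + pr.rdN du.1 (pr.bOf du.1) * (Rlev + 2) * pr.D) hK
  unfold kFF₂
  linarith

end FinePrm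

end Skelφ

end Summit.CriticalPhenomena.PercolationContinuityZ3.Theorems.Transplant

end
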